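import Summits.Ventures.PercRepro.C041TreeEmb
import Summits.Ventures.PercRepro.C041RelaxedTriangleMain

/-!
# ROW C-041 — THE TRIANGLE FED BY THE CLASS: two members of `IsZe` (tree zones, one-vertex zones, marked pendants,
…) as the exits of mine-3's triangle satisfy (P) and the ZONE O-CUBE (p6, gen 30; mine-3's THEOREM (RELAXED
TRIANGLE) for cone inputs, `C041RelaxedTriangleMain`, with the cone members by name)

Mine-3's `K4v_thetaTri_of_InCone` takes two cone members and returns (P) at the output of the triangle map
`thetaTri`; the class `IsZe` (`C041ConeClassE`) and the tree embedding (`C041TreeEmb`) supply cone members BY NAME: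
every member's six-vector (`IsZe.inCone`), in particular every canonical tree zone's (`inCone_sixVec_toZone`).  So
the triangle with two class members at its exits satisfies (P) (`K4v_thetaTri_of_isZe`) and the ZONE O-CUBE
inequality at its output (`zoneOCube_thetaTri_of_isZe`); with two tree zones (`K4v_thetaTri_of_trees`,
`zoneOCube_thetaTri_of_trees`).  The dictionary «`thetaTri` of the exits' six-vectors is the six-vector of the
triangle zone of the graph model» is mine-3's §21 (a) (paper-level); nothing about the graph model is claimed here.
-/

namespace PercRepro

namespace ZoneZ

open ZoneData TreeClosure RelaxedTriangle AZone

variable {V E T₁ T₂ V' E' T₁' T₂' : Type} {Z : ZoneData V E T₁ T₂} {Z' : ZoneData V' E' T₁' T₂'} {k : V} {k' : V'}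
  [Fintype E] [DecidableEq E] [Fintype T₁] [DecidableEq T₁] [Fintype T₂] [DecidableEq T₂] [Fintype E']
  [DecidableEq E'] [Fintype T₁'] [DecidableEq T₁'] [Fintype T₂'] [DecidableEq T₂']

/-- **(P) at the output of the triangle with two class members at its exits.** -/
theorem K4v_thetaTri_of_isZe (h : IsZe Z k) (h' : IsZe Z' k') : K4v (thetaTri (Z.sixVec k) (Z'.sixVec k')) :=
  K4v_thetaTri_of_InCone (h.inCone _ _ _ _ _ _) (h'.inCone _ _ _ _ _ _)

/-- **The ZONE O-CUBE inequality at the output of the triangle with two class members at its exits.** -/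
theorem zoneOCube_thetaTri_of_isZe (h : IsZe Z k) (h' : IsZe Z' k') :
    0 ≤ (thetaTri (Z.sixVec k) (Z'.sixVec k') 1 - thetaTri (Z.sixVec k) (Z'.sixVec k') 0) +
      (thetaTri (Z.sixVec k) (Z'.sixVec k') 2 - thetaTri (Z.sixVec k) (Z'.sixVec k') 0) +
      2 * (thetaTri (Z.sixVec k) (Z'.sixVec k') 4 + thetaTri (Z.sixVec k) (Z'.sixVec k') 5 -
        thetaTri (Z.sixVec k) (Z'.sixVec k') 3) - 2 * thetaTri (Z.sixVec k) (Z'.sixVec k') 0 :=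
  zoneOCube_thetaTri_of_InCone (h.inCone _ _ _ _ _ _) (h'.inCone _ _ _ _ _ _)

/-- (P) at the output of the triangle with two tree zones at its exits. -/
theorem K4v_thetaTri_of_trees (t t' : TZ) :
    K4v (thetaTri (t.toZone.sixVec t.root) (t'.toZone.sixVec t'.root)) :=
  K4v_thetaTri_of_InCone (inCone_sixVec_toZone t) (inCone_sixVec_toZone t')

/-- The ZONE O-CUBE inequality at the output of the triangle with two tree zones at its exits. -/
theorem zoneOCube_thetaTri_of_trees (t t' : TZ) :
    0 ≤ (thetaTri (t.toZone.sixVec t.root) (t'.toZone.sixVec t'.root) 1 -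
        thetaTri (t.toZone.sixVec t.root) (t'.toZone.sixVec t'.root) 0) +
      (thetaTri (t.toZone.sixVec t.root) (t'.toZone.sixVec t'.root) 2 -
        thetaTri (t.toZone.sixVec t.root) (t'.toZone.sixVec t'.root) 0) +
      2 * (thetaTri (t.toZone.sixVec t.root) (t'.toZone.sixVec t'.root) 4 +
        thetaTri (t.toZone.sixVec t.root) (t'.toZone.sixVec t'.root) 5 -
        thetaTri (t.toZone.sixVec t.root) (t'.toZone.sixVec t'.root) 3) -
      2 * thetaTri (t.toZone.sixVec t.root) (t'.toZone.sixVec t'.root) 0 :=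
  zoneOCube_thetaTri_of_InCone (inCone_sixVec_toZone t) (inCone_sixVec_toZone t')

end ZoneZ

end PercRepro
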